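import Literature.Probability.Percolation.DecisionTreeWeighted
import HarnessLib

/-!
# Per-class counting: a pair-event bound `Pr2W(Y) ≤ m·PrW(X)` for ALL edge weights follows from
# counting inside the classes `(C₁ ∩ C₂, C₁ ∪ C₂)`

builds on p205010 (kernel theorem, internal audit signed; external expert review pending)

Support file (`--supports stmt-CriticalPhenomena-4575`), seat `prim-quant-p1` (gen 41); memo
`run/shared/lean/prim/quant/prim-quant-p1-g41/FOR-LEAD-Z32-PCC.md` §1.  No definitions, no named facts, no sorries;
standard axioms.  Generic in the index type `ι` of Gladkov's finitary calculus (`DecisionTree.wtW/PrW/wt2W/Pr2W`).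

THE OBSERVATION.  The weight `wtW(C₁)·wtW(C₂)` of a pair of configurations depends only on its CLASS
`(I, U) = (C₁ ∩ C₂, C₁ ∪ C₂)`: it is `∏_{i∈I} p_i² · ∏_{i ∈ U∖I} p_i(1-p_i) · ∏_{i ∈ D∖U} (1-p_i)²` (`wt2W_eq_classWt`;
the prose name `classWt(I,U)` for this product and `fiber(I,U)` for the class
`{x ∈ 2^D × 2^D : x.1 ∩ x.2 = I, x.1 ∪ x.2 = U}` are written out in the statements).  Hence (`Pr2W_eq_sum_fiber`)
`Pr2W(Y) = Σ_{(I,U)} classWt(I,U) · #(Y ∩ fiber(I,U))`, and a bound `Pr2W(Y) ≤ m · Pr2W(Y')` / `≤ m · PrW(X)` for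
EVERY weight vector follows from the purely combinatorial per-class counts
`#{x ∈ fiber(I,U) : x ∈ Y} ≤ m · #{x ∈ fiber(I,U) : x.1 ∈ X}` (`Pr2W_le_mul_Pr2W_of_classCount`,
`Pr2W_le_mul_PrW_of_classCount`).  A class is a cube: `fiber(I,U) ≃ 2^{U∖I}` via `x ↦ x.2 ∖ I`
(`card_fiber_filter_eq`), i.e. its pairs are `(I ∪ (F∖T), I ∪ T)`, `T ⊆ F := U ∖ I` — "contract `I`, delete
`D ∖ U`, and let the first configuration be the COMPLEMENT of the second on the free coordinates `F`"
(`Pr2W_le_mul_PrW_of_cubeCount`).  Consequently every swap-menu / matching argument of the memo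
`prim-quant-p1-g40/FOR-LEAD-Z32-SWAPCOVER.md` §5 is equivalent to such a count (Hall's condition for the full swap
menu at capacity `m` IS the per-class count: the full menu acts transitively on each class), ANY injection inside a
class is admissible, and "for all weights" is the same as "coefficientwise in the basis `p², p(1-p), (1-p)²`".
Application to the product row F1 of the three-port programme: the companion file `…QuantProductRowClassCount`.
-/

noncomputable section

namespace Summit.CriticalPhenomena.PercolationContinuityZ3.Theorems

open Finset Literature.Probability.Percolation Literature.Probability.Percolation.DecisionTree
open scoped Classical

namespace PerClassCounting

variable {ι : Type*} [DecidableEq ι]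

/-! ### The class of a pair and its weight -/

/-- **The pair weight depends only on the class**: `wtW(C₁)·wtW(C₂) = classWt (C₁ ∩ C₂) (C₁ ∪ C₂)`
(coordinate by coordinate: `p·p`, `p(1-p) = (1-p)p`, `(1-p)(1-p)`). [this work] -/
theorem wt2W_eq_classWt (D : Finset ι) (p : ι → ℝ) (x : Finset ι × Finset ι) :
    wt2W D p x = (∏ i ∈ D, (if i ∈ (x.1 ∩ x.2) then p i * p i else if i ∈ (x.1 ∪ x.2) then p i * (1 - p i) else (1 - p i) * (1 - p i))) := by
  unfold wt2W wtW
  rw [← Finset.prod_mul_distrib]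
  refine Finset.prod_congr rfl fun i _ => ?_
  by_cases h1 : i ∈ x.1
  · by_cases h2 : i ∈ x.2
    · rw [if_pos h1, if_pos h2, if_pos (Finset.mem_inter.2 ⟨h1, h2⟩)]
    · rw [if_pos h1, if_neg h2, if_neg (fun h => h2 (Finset.mem_inter.1 h).2),
        if_pos (Finset.mem_union.2 (Or.inl h1))]
  · by_cases h2 : i ∈ x.2
    · rw [if_neg h1, if_pos h2, if_neg (fun h => h1 (Finset.mem_inter.1 h).1),
        if_pos (Finset.mem_union.2 (Or.inr h2)), mul_comm]
    · rw [if_neg h1, if_neg h2, if_neg (fun h => h1 (Finset.mem_inter.1 h).1), if_neg (fun h => ?_)]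
      rcases Finset.mem_union.1 h with h | h
      · exact h1 h
      · exact h2 h

/-- Class weights are nonnegative for `p ∈ [0, 1]`. [this work] -/
theorem classWt_nonneg (D : Finset ι) {p : ι → ℝ} (hp0 : ∀ i, 0 ≤ p i) (hp1 : ∀ i, p i ≤ 1)
    (I U : Finset ι) : 0 ≤ (∏ i ∈ D, (if i ∈ I then p i * p i else if i ∈ U then p i * (1 - p i) else (1 - p i) * (1 - p i))) := by
  refine Finset.prod_nonneg fun i _ => ?_
  have h0 := hp0 i
  have h1 : 0 ≤ 1 - p i := sub_nonneg.2 (hp1 i)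
  split_ifs
  · exact mul_nonneg h0 h0
  · exact mul_nonneg h0 h1
  · exact mul_nonneg h1 h1

/-- **Class decomposition of a pair probability**: `Pr2W(Y) = Σ_{(I,U)} classWt(I,U) · #(Y ∩ fiber(I,U))`
(the sum runs over all `(I, U)` with `I, U ⊆ D`; classes with `I ⊄ U` are empty). [this work] -/
theorem Pr2W_eq_sum_fiber (D : Finset ι) (p : ι → ℝ) (Y : Set (Finset ι × Finset ι)) [DecidablePred (· ∈ Y)] :
    Pr2W D p Y = ∑ k ∈ D.powerset ×ˢ D.powerset,
      (∏ i ∈ D, (if i ∈ k.1 then p i * p i else if i ∈ k.2 then p i * (1 - p i) else (1 - p i) * (1 - p i))) * (((((D.powerset ×ˢ D.powerset).filter fun x : Finset ι × Finset ι => (x.1 ∩ x.2, x.1 ∪ x.2) = k)).filter fun x => x ∈ Y).card : ℝ) := by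
  unfold Pr2W
  have hmaps : ∀ x ∈ D.powerset ×ˢ D.powerset,
      (fun x : Finset ι × Finset ι => (x.1 ∩ x.2, x.1 ∪ x.2)) x ∈ D.powerset ×ˢ D.powerset := by
    intro x hx
    rw [Finset.mem_product, Finset.mem_powerset, Finset.mem_powerset] at hx ⊢
    exact ⟨Finset.inter_subset_left.trans hx.1, Finset.union_subset hx.1 hx.2⟩
  rw [← Finset.sum_fiberwise_of_maps_to hmaps]
  refine Finset.sum_congr rfl fun k _ => ?_
  have hcongr : ∀ x ∈ (D.powerset ×ˢ D.powerset).filter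
      (fun x : Finset ι × Finset ι => (x.1 ∩ x.2, x.1 ∪ x.2) = k),
      Y.indicator (wt2W D p) x = if x ∈ Y then (∏ i ∈ D, (if i ∈ k.1 then p i * p i else if i ∈ k.2 then p i * (1 - p i) else (1 - p i) * (1 - p i))) else 0 := by
    intro x hx
    have hk : (x.1 ∩ x.2, x.1 ∪ x.2) = k := (Finset.mem_filter.1 hx).2
    by_cases hY : x ∈ Y
    · rw [Set.indicator_of_mem hY, if_pos hY, wt2W_eq_classWt, ← hk]
    · rw [Set.indicator_of_notMem hY, if_neg hY]
  rw [Finset.sum_congr rfl hcongr, Finset.sum_ite, Finset.sum_const_zero, add_zero, Finset.sum_const,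
    nsmul_eq_mul, mul_comm]

/-- **Per-class counting ⟹ a weighted comparison of two pair events.**  If in every class `(I, U)`,
`I ⊆ U ⊆ D`, the number of pairs in `Y` is at most `m` times the number of pairs in `Y'`, then
`Pr2W(Y) ≤ m · Pr2W(Y')` for every weight vector `p ∈ [0,1]^D` (all pairs of a class weigh the same). [this work] -/
theorem Pr2W_le_mul_Pr2W_of_classCount (D : Finset ι) {p : ι → ℝ} (hp0 : ∀ i, 0 ≤ p i) (hp1 : ∀ i, p i ≤ 1)
    (Y Y' : Set (Finset ι × Finset ι)) [DecidablePred (· ∈ Y)] [DecidablePred (· ∈ Y')] {m : ℝ}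
    (h : ∀ I U : Finset ι, I ⊆ U → U ⊆ D →
      ((((((D.powerset ×ˢ D.powerset).filter fun x : Finset ι × Finset ι => (x.1 ∩ x.2, x.1 ∪ x.2) = (I, U))).filter fun x => x ∈ Y).card : ℝ)) ≤
        m * (((((D.powerset ×ˢ D.powerset).filter fun x : Finset ι × Finset ι => (x.1 ∩ x.2, x.1 ∪ x.2) = (I, U))).filter fun x => x ∈ Y').card : ℝ)) :
    Pr2W D p Y ≤ m * Pr2W D p Y' := by
  rw [Pr2W_eq_sum_fiber, Pr2W_eq_sum_fiber, Finset.mul_sum]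
  refine Finset.sum_le_sum fun k _ => ?_
  have hw := classWt_nonneg D hp0 hp1 k.1 k.2
  by_cases hne : (((D.powerset ×ˢ D.powerset).filter fun x : Finset ι × Finset ι => (x.1 ∩ x.2, x.1 ∪ x.2) = k)).Nonempty
  · obtain ⟨x, hx⟩ := hne
    have hx' := Finset.mem_filter.1 hx
    rw [Finset.mem_product, Finset.mem_powerset, Finset.mem_powerset] at hx'
    obtain ⟨⟨hx1, hx2⟩, hxk⟩ := hx'
    have hIU : k.1 ⊆ k.2 := by
      rw [← hxk]
      exact Finset.inter_subset_left.trans Finset.subset_union_left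
    have hUD : k.2 ⊆ D := by
      rw [← hxk]
      exact Finset.union_subset hx1 hx2
    have hk' := h k.1 k.2 hIU hUD
    calc (∏ i ∈ D, (if i ∈ k.1 then p i * p i else if i ∈ k.2 then p i * (1 - p i) else (1 - p i) * (1 - p i))) * ((((((D.powerset ×ˢ D.powerset).filter fun x : Finset ι × Finset ι => (x.1 ∩ x.2, x.1 ∪ x.2) = k)).filter fun x => x ∈ Y).card : ℝ))
        ≤ (∏ i ∈ D, (if i ∈ k.1 then p i * p i else if i ∈ k.2 then p i * (1 - p i) else (1 - p i) * (1 - p i))) * (m * (((((D.powerset ×ˢ D.powerset).filter fun x : Finset ι × Finset ι => (x.1 ∩ x.2, x.1 ∪ x.2) = k)).filter fun x => x ∈ Y').card : ℝ)) :=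
          mul_le_mul_of_nonneg_left hk' hw
      _ = m * ((∏ i ∈ D, (if i ∈ k.1 then p i * p i else if i ∈ k.2 then p i * (1 - p i) else (1 - p i) * (1 - p i))) * (((((D.powerset ×ˢ D.powerset).filter fun x : Finset ι × Finset ι => (x.1 ∩ x.2, x.1 ∪ x.2) = k)).filter fun x => x ∈ Y').card : ℝ)) := by ring
  · rw [Finset.not_nonempty_iff_eq_empty] at hne
    simp [hne]

/-- **Per-class counting ⟹ a weighted pair bound.**  If in every class `(I, U)`, `I ⊆ U ⊆ D`, the number of
pairs in `Y` is at most `m` times the number of pairs whose FIRST configuration lies in `X`, then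
`Pr2W(Y) ≤ m · PrW(X)` for every weight vector `p ∈ [0,1]^D`.  (Within a class all pairs weigh the same, so any
injection — not only Gladkov swaps — may be used to establish the count.) [this work] -/
theorem Pr2W_le_mul_PrW_of_classCount (D : Finset ι) {p : ι → ℝ} (hp0 : ∀ i, 0 ≤ p i) (hp1 : ∀ i, p i ≤ 1)
    (Y : Set (Finset ι × Finset ι)) (X : Set (Finset ι)) [DecidablePred (· ∈ Y)] [DecidablePred (· ∈ X)]
    {m : ℝ} (hm : 0 ≤ m)
    (h : ∀ I U : Finset ι, I ⊆ U → U ⊆ D →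
      ((((((D.powerset ×ˢ D.powerset).filter fun x : Finset ι × Finset ι => (x.1 ∩ x.2, x.1 ∪ x.2) = (I, U))).filter fun x => x ∈ Y).card : ℝ)) ≤
        m * (((((D.powerset ×ˢ D.powerset).filter fun x : Finset ι × Finset ι => (x.1 ∩ x.2, x.1 ∪ x.2) = (I, U))).filter fun x => x.1 ∈ X).card : ℝ)) :
    Pr2W D p Y ≤ m * PrW D p X := by
  have hX : PrW D p X = Pr2W D p (X ×ˢ (Set.univ : Set (Finset ι))) := by
    rw [Pr2W_prod, PrW_univ, mul_one]
  rw [hX]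
  refine Pr2W_le_mul_Pr2W_of_classCount D hp0 hp1 Y _ fun I U hIU hUD => (h I U hIU hUD).trans ?_
  refine mul_le_mul_of_nonneg_left (Nat.cast_le.2 (Finset.card_le_card fun x hx => ?_)) hm
  rw [Finset.mem_filter] at hx ⊢
  exact ⟨hx.1, Set.mk_mem_prod hx.2 (Set.mem_univ _)⟩

/-! ### A class is a cube: `fiber (I, U) ≃ 2^{U ∖ I}` -/

/-- **The class `(I,U)` is the cube over the free coordinates `F = U ∖ I`**: its pairs are exactly
`(I ∪ (F ∖ T), I ∪ T)`, `T ⊆ F` (the second configuration restricted to `F` is `T`, the first is its complement),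
so every count in a class is a count of subsets of `F`. [this work] -/
theorem card_fiber_filter_eq (D : Finset ι) {I U : Finset ι} (hIU : I ⊆ U) (hUD : U ⊆ D)
    (Q : Finset ι × Finset ι → Prop) [DecidablePred Q] :
    ((((D.powerset ×ˢ D.powerset).filter fun x : Finset ι × Finset ι => (x.1 ∩ x.2, x.1 ∪ x.2) = (I, U))).filter fun x => Q x).card =
      (((U \ I).powerset).filter fun T => Q (I ∪ ((U \ I) \ T), I ∪ T)).card := by
  symm
  refine Finset.card_nbij' (fun T => (I ∪ ((U \ I) \ T), I ∪ T)) (fun x => x.2 \ I) ?_ ?_ ?_ ?_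
  · -- into the fiber
    intro T hT
    rw [Finset.mem_coe, Finset.mem_filter, Finset.mem_powerset] at hT
    obtain ⟨hTF, hQ⟩ := hT
    rw [Finset.mem_coe, Finset.mem_filter]
    refine ⟨Finset.mem_filter.2 ⟨?_, ?_⟩, hQ⟩
    · rw [Finset.mem_product, Finset.mem_powerset, Finset.mem_powerset]
      constructor
      · exact Finset.union_subset (hIU.trans hUD) (Finset.sdiff_subset.trans (Finset.sdiff_subset.trans hUD))
      · exact Finset.union_subset (hIU.trans hUD) (hTF.trans (Finset.sdiff_subset.trans hUD))
    · have h1 : (I ∪ ((U \ I) \ T)) ∩ (I ∪ T) = I := by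
        ext i
        have hi1 : i ∈ I → i ∈ U := fun h => hIU h
        have hi2 : i ∈ T → i ∈ U \ I := fun h => hTF h
        simp only [Finset.mem_inter, Finset.mem_union, Finset.mem_sdiff] at hi2 ⊢
        tauto
      have h2 : (I ∪ ((U \ I) \ T)) ∪ (I ∪ T) = U := by
        ext i
        have hi1 : i ∈ I → i ∈ U := fun h => hIU h
        have hi2 : i ∈ T → i ∈ U \ I := fun h => hTF h
        simp only [Finset.mem_union, Finset.mem_sdiff] at hi2 ⊢
        tauto
      rw [h1, h2]
  · -- out of the fiber
    intro x hx
    rw [Finset.mem_coe, Finset.mem_filter] at hx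
    obtain ⟨hx, hQ⟩ := hx
    obtain ⟨hxD, hk⟩ := Finset.mem_filter.1 hx
    simp only [Prod.mk.injEq] at hk
    obtain ⟨hI, hU⟩ := hk
    rw [Finset.mem_coe, Finset.mem_filter, Finset.mem_powerset]
    have h1 : I ∪ ((U \ I) \ (x.2 \ I)) = x.1 := by
      ext i
      simp only [Finset.mem_union, Finset.mem_sdiff, ← hI, ← hU, Finset.mem_inter]
      tauto
    have h2 : I ∪ (x.2 \ I) = x.2 := by
      ext i
      simp only [Finset.mem_union, Finset.mem_sdiff, ← hI, Finset.mem_inter]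
      tauto
    refine ⟨?_, ?_⟩
    · intro i hi
      rw [Finset.mem_sdiff] at hi ⊢
      rw [← hU, Finset.mem_union]
      exact ⟨Or.inr hi.1, hi.2⟩
    · rw [h1, h2]
      exact hQ
  · -- left inverse on subsets
    intro T hT
    rw [Finset.mem_coe, Finset.mem_filter, Finset.mem_powerset] at hT
    obtain ⟨hTF, _⟩ := hT
    ext i
    simp only [Finset.mem_sdiff, Finset.mem_union]
    constructor
    · rintro ⟨h | h, hnI⟩
      · exact absurd h hnI
      · exact h
    · intro h
      exact ⟨Or.inr h, (Finset.mem_sdiff.1 (hTF h)).2⟩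
  · -- right inverse on the fiber
    intro x hx
    rw [Finset.mem_coe, Finset.mem_filter] at hx
    obtain ⟨hx, _⟩ := hx
    obtain ⟨_, hk⟩ := Finset.mem_filter.1 hx
    simp only [Prod.mk.injEq] at hk
    obtain ⟨hI, hU⟩ := hk
    ext i
    · simp only [Finset.mem_union, Finset.mem_sdiff, ← hI, ← hU, Finset.mem_inter]
      tauto
    · simp only [Finset.mem_union, Finset.mem_sdiff, ← hI, Finset.mem_inter]
      tauto

/-- Counting subsets `T ⊆ F` with a property of the complement `F ∖ T` is counting subsets with the property
(the complement is an involution of `2^F`). [this work] -/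
theorem card_filter_powerset_compl (F : Finset ι) (Q : Finset ι → Prop) [DecidablePred Q] :
    ((F.powerset).filter fun T => Q (F \ T)).card = ((F.powerset).filter fun T => Q T).card := by
  refine Finset.card_nbij' (fun T => F \ T) (fun T => F \ T) ?_ ?_ ?_ ?_
  · intro T hT
    rw [Finset.mem_coe, Finset.mem_filter, Finset.mem_powerset] at hT ⊢
    exact ⟨Finset.sdiff_subset, hT.2⟩
  · intro T hT
    rw [Finset.mem_coe, Finset.mem_filter, Finset.mem_powerset] at hT ⊢
    refine ⟨Finset.sdiff_subset, ?_⟩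
    rw [Finset.sdiff_sdiff_eq_self hT.1]
    exact hT.2
  · intro T hT
    rw [Finset.mem_coe, Finset.mem_filter, Finset.mem_powerset] at hT
    exact Finset.sdiff_sdiff_eq_self hT.1
  · intro T hT
    rw [Finset.mem_coe, Finset.mem_filter, Finset.mem_powerset] at hT
    exact Finset.sdiff_sdiff_eq_self hT.1

/-- **Per-class counting, cube form.**  If for all `I ⊆ U ⊆ D`, `F = U ∖ I`:
`#{T ⊆ F : (I ∪ (F ∖ T), I ∪ T) ∈ Y} ≤ m · #{T ⊆ F : I ∪ T ∈ X}`, then `Pr2W(Y) ≤ m · PrW(X)` for every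
`p ∈ [0,1]^D`. [this work] -/
theorem Pr2W_le_mul_PrW_of_cubeCount (D : Finset ι) {p : ι → ℝ} (hp0 : ∀ i, 0 ≤ p i) (hp1 : ∀ i, p i ≤ 1)
    (Y : Set (Finset ι × Finset ι)) (X : Set (Finset ι)) [DecidablePred (· ∈ Y)] [DecidablePred (· ∈ X)]
    {m : ℝ} (hm : 0 ≤ m)
    (h : ∀ I U : Finset ι, I ⊆ U → U ⊆ D →
      ((((U \ I).powerset).filter fun T => (I ∪ ((U \ I) \ T), I ∪ T) ∈ Y).card : ℝ) ≤
        m * ((((U \ I).powerset).filter fun T => I ∪ T ∈ X).card : ℝ)) :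
    Pr2W D p Y ≤ m * PrW D p X := by
  refine Pr2W_le_mul_PrW_of_classCount D hp0 hp1 Y X hm fun I U hIU hUD => ?_
  rw [card_fiber_filter_eq D hIU hUD (fun x => x ∈ Y), card_fiber_filter_eq D hIU hUD (fun x => x.1 ∈ X)]
  have hc := card_filter_powerset_compl (U \ I) (fun T => I ∪ T ∈ X)
  rw [hc]
  exact h I U hIU hUD

end PerClassCounting

end Summit.CriticalPhenomena.PercolationContinuityZ3.Theorems
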